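import Literature.Analysis.FluidPDE.NSBoundedMildAnalytic
import Literature.Analysis.FluidPDE.TypeIAncientMild
import HarnessLib

/-!
# Type-I ancient mild fields are jointly real-analytic in space and time

Analysis/FluidPDE proofs file (theorems only: no definitions, no named facts, no `sorry`).  Lemarié-Rieusset,
*The Navier–Stokes problem in the 21st century* (2016), Thm. 9.12: bounded mild solutions of the Navier–Stokes equations are
real-analytic in space AND time.  The tree holds the PROVED local form `lemarieRieusset2016_local_analyticity_holds` (the Oseen
fixed point from a bounded datum is jointly real-analytic on its window) and its spatial consequence for the Type-I ancient mild
class, `IsTypeIAncientMild.analyticOnNhd_slice_univ` (`BarkerPrange2020VorticityAlignmentTypeIHolds.lean`).  This file records the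
JOINT and the TEMPORAL consequences, by the same argument with the identification `U = v` made at every time of the window:

* `IsTypeIAncientMild.analyticAt_uncurry` — `(σ, x) ↦ U σ x` is real-analytic at every `(t, x)`, `t < 0`;
* `IsTypeIAncientMild.analyticAt_time` — for every `x`, the time signal `σ ↦ U σ x` is real-analytic at every `t < 0`
  (hence enjoys unique continuation in time: the input «A» of the rungs R3/R4 of the crux workfile
  `Summits/…/Cruxes/NearExtremalTransiencePerFlow/Lines/filament_selection.lean`).

Proof: on the window `(s₁, T₂) ∋ t`, `s₁ = t − ε/(2(B+1)²)`, `T₂ = min (s₁ + ε/(B+1)²) (t/2)`, `B = C/√(-t/2)`, the analytic Oseen fixed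
point `v` from the bounded datum `U s₁` and the field `U` both solve `w(τ) = e^{(τ-s₁)Δ}U(s₁) − B¹_{s₁}(w,w)(τ)` and are bounded, so they
agree a.e. at every time (`oseenMild_bounded_unique`), hence everywhere (continuous slices); `U = v` on the open set
`(s₁, T₂) × ℝ³ ∋ (t, x)` and `v` is analytic there.  (Sharper, not needed: Dong–Zhang, JFA 279 (2020), Thm 2.)

## References
* P. G. Lemarié-Rieusset, *The Navier–Stokes problem in the 21st century*, CRC Press 2016, Thm. 9.12 (PDF p. 260). [LemarieRieusset2016]
* G. Koch, N. Nadirashvili, G. Seregin, V. Šverák, Acta Math. 203 (2009), §4 (uniqueness of bounded mild solutions). [KochNadirashviliSereginSverak2009]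
-/

noncomputable section

open MeasureTheory Set Function Filter Topology
open scoped ENNReal

namespace Literature.Analysis.FluidPDE

/-- **Type-I ancient mild fields are jointly real-analytic in space–time** (Lemarié-Rieusset 2016, Thm. 9.12, through the tree's
PROVED local form `lemarieRieusset2016_local_analyticity_holds` and the uniqueness of bounded Oseen-mild solutions
`oseenMild_bounded_unique`): `uncurry U` is analytic at every `(t, x)` with `t < 0`. [cite: LemarieRieusset2016, Thm. 9.12 (PDF p. 260)] -/
theorem IsTypeIAncientMild.analyticAt_uncurry {C : ℝ}
    {U : ℝ → (EuclideanSpace ℝ (Fin 3)) → (EuclideanSpace ℝ (Fin 3))}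
    (h : IsTypeIAncientMild C U) {t : ℝ} (ht : t < 0) (x : EuclideanSpace ℝ (Fin 3)) :
    AnalyticAt ℝ (uncurry U) (t, x) := by
  -- adapted from `IsTypeIAncientMild.analyticOnNhd_slice_univ` (same window, identification at every time)
  obtain ⟨ε, hε, C₀, hC₀, hloc⟩ := lemarieRieusset2016_local_analyticity_holds
  have hC : 0 ≤ C := h.nonneg
  set B : ℝ := C / Real.sqrt (-(t / 2)) with hB
  have hB0 : 0 ≤ B := div_nonneg hC (Real.sqrt_nonneg _)
  have hnormle : ∀ τ, τ ≤ t / 2 → ∀ x, ‖U τ x‖ ≤ B := by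
    intro τ hτ x
    have hτ0 : τ < 0 := by linarith
    refine (h.norm_le hτ0 x).trans ?_
    exact div_le_div_of_nonneg_left hC (Real.sqrt_pos.2 (by linarith)) (Real.sqrt_le_sqrt (by linarith))
  set Mb : ℝ := B + 1 with hMb
  have hMb0 : 0 < Mb := by rw [hMb]; linarith
  have hlen : 0 < ε * 1 / Mb ^ 2 := by positivity
  set s₁ : ℝ := t - (ε * 1 / Mb ^ 2) / 2 with hs₁
  have hs₁t : s₁ < t := by rw [hs₁]; linarith
  have hs₁0 : s₁ < 0 := by linarith
  have ha_meas : AEStronglyMeasurable (U s₁) volume := (h.continuous_slice hs₁0).aestronglyMeasurable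
  have ha_bd : eLpNorm (U s₁) ∞ volume ≤ ENNReal.ofReal Mb := by
    rw [eLpNorm_exponent_top]
    refine eLpNormEssSup_le_of_ae_bound (Eventually.of_forall fun x => ?_)
    exact (hnormle s₁ (by linarith) x).trans (by rw [hMb]; linarith)
  obtain ⟨vl, hvl_an, hvl_eq, hvl_bd⟩ := hloc one_pos s₁ hMb0 ha_meas ha_bd
  set T₂ : ℝ := min (s₁ + ε * 1 / Mb ^ 2) (t / 2) with hT₂
  have htT₂ : t < T₂ := lt_min (by rw [hs₁]; linarith) (by linarith)
  have hT₂0 : T₂ < 0 := (min_le_right _ _).trans_lt (by linarith)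
  have hT₂h : T₂ ≤ s₁ + ε * 1 / Mb ^ 2 := min_le_left _ _
  have hT₂t : T₂ ≤ t / 2 := min_le_right _ _
  set M' : ℝ := max B (C₀ * Mb) with hM'
  have hM'0 : 0 ≤ M' := hB0.trans (le_max_left _ _)
  have hum : AEStronglyMeasurable (uncurry U) (volume.restrict (Ioo s₁ T₂ ×ˢ univ)) :=
    (h.continuousOn_uncurry.mono (prod_mono (fun τ hτ => mem_Iio.2 ((mem_Ioo.1 hτ).2.trans hT₂0))
      Subset.rfl)).aestronglyMeasurable (measurableSet_Ioo.prod MeasurableSet.univ)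
  have hvm : AEStronglyMeasurable (uncurry vl) (volume.restrict (Ioo s₁ T₂ ×ˢ univ)) :=
    (hvl_an.continuousOn.mono (prod_mono (Ioo_subset_Ioo_right hT₂h) Subset.rfl)).aestronglyMeasurable
      (measurableSet_Ioo.prod MeasurableSet.univ)
  have huM : ∀ τ ∈ Ioo s₁ T₂, ∀ y, ‖U τ y‖ ≤ M' := fun τ hτ y =>
    (hnormle τ (hτ.2.le.trans hT₂t) y).trans (le_max_left _ _)
  have hvM : ∀ τ ∈ Ioo s₁ T₂, ∀ y, ‖vl τ y‖ ≤ M' := fun τ hτ y =>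
    (hvl_bd τ ⟨hτ.1, hτ.2.trans_le hT₂h⟩ y).trans (le_max_right _ _)
  have hu : ∀ τ ∈ Ioo s₁ T₂, U τ =ᵐ[volume] fun x =>
      UnboundedOperators.heatExtension (U s₁) (1 * (τ - s₁)) x - oseenDuhamel 1 s₁ U U τ x :=
    fun τ hτ => Eventually.of_forall fun x => by
      rw [one_mul]
      exact h.mild_eq_heatExtension hτ.1 (hτ.2.trans hT₂0) x
  have hv : ∀ τ ∈ Ioo s₁ T₂, vl τ =ᵐ[volume] fun x =>
      UnboundedOperators.heatExtension (U s₁) (1 * (τ - s₁)) x - oseenDuhamel 1 s₁ vl vl τ x :=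
    fun τ hτ => Eventually.of_forall fun x => hvl_eq τ ⟨hτ.1, hτ.2.trans_le hT₂h⟩ x
  have heq := oseenMild_bounded_unique
    (U := fun τ x => UnboundedOperators.heatExtension (U s₁) (1 * (τ - s₁)) x)
    one_pos hM'0 hum hvm huM hvM hu hv
  -- identification at EVERY time of the window (continuous slices)
  have hUv : ∀ τ ∈ Ioo s₁ T₂, U τ = vl τ := by
    intro τ hτ
    have hτw : τ ∈ Ioo s₁ (s₁ + ε * 1 / Mb ^ 2) := ⟨hτ.1, hτ.2.trans_le hT₂h⟩
    have hvlτ : AnalyticOnNhd ℝ (vl τ) univ := analyticOnNhd_slice hvl_an hτw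
    exact (Continuous.ae_eq_iff_eq volume (h.continuous_slice (hτ.2.trans hT₂0))
      (continuousOn_univ.1 hvlτ.continuousOn)).1 (heq τ hτ)
  -- `uncurry U = uncurry vl` near `(t, x)`, and `uncurry vl` is analytic there
  have hmem : (t, x) ∈ Ioo s₁ (s₁ + ε * 1 / Mb ^ 2) ×ˢ (univ : Set (EuclideanSpace ℝ (Fin 3))) :=
    ⟨⟨hs₁t, htT₂.trans_le hT₂h⟩, mem_univ _⟩
  have hvan : AnalyticAt ℝ (uncurry vl) (t, x) := hvl_an (t, x) hmem
  have hnhds : Ioo s₁ T₂ ×ˢ (univ : Set (EuclideanSpace ℝ (Fin 3))) ∈ 𝓝 (t, x) :=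
    (isOpen_Ioo.prod isOpen_univ).mem_nhds ⟨⟨hs₁t, htT₂⟩, mem_univ _⟩
  have hcongr : uncurry vl =ᶠ[𝓝 (t, x)] uncurry U := by
    filter_upwards [hnhds] with q hq
    show vl q.1 q.2 = U q.1 q.2
    rw [hUv q.1 hq.1]
  exact hvan.congr hcongr

/-- **Time analyticity of Type-I ancient mild fields** (Lemarié-Rieusset 2016, Thm. 9.12; cf. Dong–Zhang 2020, Thm 2 for the
quantitative form): for every point `x` the time signal `σ ↦ U σ x` is real-analytic at every `t < 0`.  In particular it enjoys
unique continuation in time on `(-∞, 0)`. [cite: LemarieRieusset2016, Thm. 9.12 (PDF p. 260)] -/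
theorem IsTypeIAncientMild.analyticAt_time {C : ℝ}
    {U : ℝ → (EuclideanSpace ℝ (Fin 3)) → (EuclideanSpace ℝ (Fin 3))}
    (h : IsTypeIAncientMild C U) {t : ℝ} (ht : t < 0) (x : EuclideanSpace ℝ (Fin 3)) :
    AnalyticAt ℝ (fun σ : ℝ => U σ x) t := by
  have hj := h.analyticAt_uncurry ht x
  have hι : AnalyticAt ℝ (fun σ : ℝ => ((σ, x) : ℝ × EuclideanSpace ℝ (Fin 3))) t :=
    analyticAt_id.prod analyticAt_const
  have h2 : AnalyticAt ℝ (uncurry U ∘ fun σ : ℝ => ((σ, x) : ℝ × EuclideanSpace ℝ (Fin 3))) t :=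
    hj.comp_of_eq hι rfl
  simpa only [Function.comp_def, Function.uncurry_apply_pair] using h2

/-- The time signals are real-analytic on the whole of `(-∞, 0)`. [cite: LemarieRieusset2016, Thm. 9.12 (PDF p. 260)] -/
theorem IsTypeIAncientMild.analyticOnNhd_time {C : ℝ}
    {U : ℝ → (EuclideanSpace ℝ (Fin 3)) → (EuclideanSpace ℝ (Fin 3))}
    (h : IsTypeIAncientMild C U) (x : EuclideanSpace ℝ (Fin 3)) :
    AnalyticOnNhd ℝ (fun σ : ℝ => U σ x) (Iio 0) :=
  fun _ ht => h.analyticAt_time ht x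

end Literature.Analysis.FluidPDE

end
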